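import Mathlib
import HarnessLib
import Summits.HubbardSuperconductivity.HubbardSuperconductivity.Theorems.KLProgrammeKLRegimeEngineTowerWtRemeasureBase
import Summits.HubbardSuperconductivity.HubbardSuperconductivity.Theorems.KLProgrammeKLRegimeEngineTowerWtLawBaseTokX
import Summits.HubbardSuperconductivity.HubbardSuperconductivity.Theorems.KLProgrammeKLRegimeEngineTowerBlockIncrWtKlEngAll

/-!
# Route `KLProgramme` — crux K3 ENGINE (stmt-HubbardSuperconductivity-20437 `KLRegimeEngineV17F2`), stub (b) v2, THE WEIGHTED HALF «(b)-WT4»: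
# W3b — THE RE-BASED WEIGHTED MEASURED PROFILE ON THE FLOW FRAME and THE WEIGHTED LAW WITH THE BRIDGE DISCHARGED («R-rows-W»; the PRODUCER of the bridge
# `hR` of W1 `klTowerBornWtAt_le_law_of_inputs_base_tokX`; cell gate-hubbard-kl, seat hubbard-kl-k3c3-p2 g17; weighted twin of …TowerInstProfileLevRateFBase
# (p4 g19) at track `t = 0`, on W3a's floor-kit-unit row; E1 may rename or supersede)

W3a (`klTowerMeasWtAt_div_le_kitSum_base_klEng`) bounds the measured weighted array of block `k ≥ 2` in track-`0` floor units by
`C₁C₂^{2p−1}·( ((2^{p−3})⁻¹)^{d(k−1)}·N_b/unitF(p,d−1) + Σ_{1≤k′<k} 2^{p−3}((2^d)⁻¹)^{(p−3)(k−k′)}·b(k′+1) )`.  With the base law `N_b(p)/unitF(p,d−1) ≤ A_bλ^{p−1}Q_b^p`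
and the law `b k′ p ≤ Aλ^{p−1}Q^p` on the blocks `2 ≤ k′ ≤ k`, the rate `ρ = (2^d)⁻¹` and the block gain `((2^{d−1})⁻¹)^{p−3} ≤ 8^{d−1}·((2^{d−1})⁻¹)^p` give the
SAME `(A′, Q′)` shape as the levelled R-rows-F WITHOUT the parents factor `27⁵`:
  **`A_R = (C₁/C₂)·8^{d−1}·(A_b + A/(1 − (2^d)⁻¹))`, `Q_R = C₂²·(2^{d−1})⁻¹·max Q Q_b`.**
* §1 **`klTowerMeasWtAt_div_le_profileR_base_klEng (R c″)`** — on `K_n`, `2 ≤ d`, `2 ≤ k`, `dk−1 ≤ n`, rate `j ≥ dk−1`, cap `D`, base datum `N_b : ℕ → ℝ` with its unit law,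
  IH on the blocks `2 … k`: for every `4 ≤ p ≤ D`, `klTowerMeasWtAt … d k j (2p)/klLevUnitF β M 0 p (dk−1) ≤ A_R·λ^{p−1}·Q_R^p`;
* §2 **`klTowerBornWtAt_le_law_of_base_rows_klEng_tokX (R c″)`** — W1 at `K := K_n` with `hR` DISCHARGED by §1: remaining NAMED inputs = the base datum rows
  `N_b`/unit law (p3's weighted grid step at `(Λ_d, F_{d−1})`, rate `j`), the block-`1` profile, the three imports at every block, the token (`hZ1`, `hZsucc`), the
  tokenised weighted step (W2b `wtLaw_hstep_klEng_tok` serves it) and the kit's numerics at `A′ ≥ W·A_R`, `Q′ ≥ Z·Q_R`; conclusion = token ∧ law ∧ exported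
  profile rows, as W1.
Compositions of landed theorems and real algebra; nothing about the model is asserted beyond them; nothing asserts (b), (ℓ), any stub, K3 or superconductivity.
References: BGM 2006 §2.8 (2.83), (2.93)–(2.98), §3 (3.2)–(3.8) [cite: BenfattoGiulianiMastropietro2006].
-/

noncomputable section

namespace Summit.HubbardSuperconductivity.HubbardSuperconductivity.Theorems.EngineV8

set_option linter.dupNamespace false -- summit = problem name (single-conjunct summit), D-0017

open Classical
open Real Finset Literature.MathematicalPhysics.QuantumLattice Literature.Probability.LatticeModels GrassmannAlgebra
open Literature.MathematicalPhysics.QuantumLattice.FermiRG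
open Summit.HubbardSuperconductivity.HubbardSuperconductivity.Theorems.KLProgrammeLegKernels
open Summit.HubbardSuperconductivity.HubbardSuperconductivity.Theorems.KLRegimeSplit
open Summit.HubbardSuperconductivity.HubbardSuperconductivity.Theorems.DispersionFlow

variable {L M : ℕ} [NeZero L] [NeZero M]

/-! ## §1 The re-based weighted measured profile from the law, on the flow frame -/

omit [NeZero L] [NeZero M] in
/-- **THE RE-BASED WEIGHTED MEASURED PROFILE FROM THE LAW** (R-rows-W): under the binders of W3a's row, for `2 ≤ d`, `2 ≤ k`, `dk − 1 ≤ n`, rate `j ≥ dk − 1`, a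
degree cap `D`, nonnegative `A, λ, Q, A_b, Q_b`, base bounds `N_b p` (rate-`j` weighted pinned sums of `𝒱_d` at `F_{d−1}`, degree `2p`) with the base law
`N_b p / klLevUnitF β M 0 p (d−1) ≤ A_b λ^{p−1} Q_b^p` (`3 ≤ p`) and the law on the born arrays of the blocks `2 ≤ k′ ≤ k` (`3 ≤ p ≤ D`): for every `4 ≤ p ≤ D`,
`klTowerMeasWtAt … d k j (2p) / klLevUnitF β M 0 p (dk−1) ≤ (C₁/C₂)·8^{d−1}·(A_b + A/(1 − (2^d)⁻¹))·λ^{p−1}·(C₂²(2^{d−1})⁻¹·max Q Q_b)^p`.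
[cite: BenfattoGiulianiMastropietro2006, §2.8 (2.83), (2.93)-(2.98)] -/
theorem klTowerMeasWtAt_div_le_profileR_base_klEng (R : RenConsts) (c'' : ℝ) (hc'' : 0 ≤ c'') :
    ∃ C₁ C₂ : ℝ, 0 < C₁ ∧ 0 < C₂ ∧ (R.WF2 → ∃ c₃' : ℝ, 0 < c₃' ∧ ∃ U₀' : ℝ, 0 < U₀' ∧
      ∀ (G : GeoConsts) (P : SplitConsts) (Q : EngConsts) (cc : ℝ), 0 < cc → cc ≤ klEngC₃6 P R → cc ≤ c₃' →
      ∀ μ ∈ klWindowC, ∀ U : ℝ, 0 < U → U ≤ min (klEngU₀3 P R cc) (1 / (R.Gfr 3 + 1)) → U ≤ U₀' → c'' * U ≤ 1 →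
      ∀ β : ℝ, klBetaMin ≤ β → β ≤ Real.exp (cc / U ^ 2) →
      ∀ (L M : ℕ) [NeZero L] [NeZero M], klEngL₃ β U ≤ L → klEngM₃ β U L ≤ M →
      ∀ n : ℕ, 1 ≤ n → n ≤ nScales β + 1 → IsKLRegime U cc (-(n : ℤ)) → HistP klPredsV17F2 L M G P Q R β U μ 0 n →
        (∀ m', 1 ≤ m' → m' < n → FlowPieceOscAt L M c'' β U μ m') →
      ∀ d k : ℕ, 2 ≤ d → 2 ≤ k → d * k - 1 ≤ n → ∀ j : ℕ, d * k - 1 ≤ j → ∀ D : ℕ,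
      ∀ (A lam Q' Ab Qb : ℝ), 0 ≤ A → 0 ≤ lam → 0 ≤ Q' → 0 ≤ Ab → 0 ≤ Qb →
      ∀ Nb : ℕ → ℝ, (∀ p, 0 ≤ Nb p) →
        (∀ (p : ℕ) (q : Fin (2 * p)) (w' : SpaceTimeIdx L M × SectorLeg (sectorCount (d - 1))),
          klWtPinnedSumAt L M β μ (klFlowFrameU L M β U μ n) (d - 1) j (2 * p) (klTowerInput L M β U μ (klFlowFrameU L M β U μ n) d 1) q w' ≤ Nb p) →
        (∀ p : ℕ, 3 ≤ p → Nb p / klLevUnitF β M 0 p (d - 1) ≤ Ab * lam ^ (p - 1) * Qb ^ p) →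
        (∀ k' : ℕ, 2 ≤ k' → k' ≤ k → ∀ p : ℕ, 3 ≤ p → p ≤ D →
          klTowerBornWtAt L M β U μ (klFlowFrameU L M β U μ n) d (k' - 1) j (2 * p) / klLevUnitF β M 0 p (d * (k' - 1)) ≤ A * lam ^ (p - 1) * Q' ^ p) →
      ∀ p : ℕ, 4 ≤ p → p ≤ D →
        klTowerMeasWtAt L M β U μ (klFlowFrameU L M β U μ n) d k j (2 * p) / klLevUnitF β M 0 p (d * k - 1) ≤
          (C₁ / C₂) * (8 : ℝ) ^ (d - 1) * (Ab + A / (1 - ((2 : ℝ) ^ d)⁻¹)) * lam ^ (p - 1) *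
            (C₂ ^ 2 * ((2 : ℝ) ^ (d - 1))⁻¹ * max Q' Qb) ^ p) := by
  obtain ⟨C₁, C₂, hC₁, hC₂, h⟩ := klTowerMeasWtAt_div_le_kitSum_base_klEng R c'' hc''
  refine ⟨C₁, C₂, hC₁, hC₂, fun hR2 => ?_⟩
  obtain ⟨c₃, hc₃, U₀, hU₀, h'⟩ := h hR2
  refine ⟨c₃, hc₃, U₀, hU₀, ?_⟩
  intro G P Q cc hcc hcc6 hcc₃' μ hμ U hU hUle hU₀' hcU β hβmin hβc L M _ _ hL3 hM3 n hn1 hnN hkl hhist hosc d k hd hk2 hkn j hj D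
    A lam Q' Ab Qb hA hlam hQ hAb hQb Nb hNb0 hcar hlawb hIH p hp hpD
  have hβ : 0 < β := KLRegimeSplit.pos_of_klBetaMin_le hβmin
  set K : TrigPolyC4v := klFlowFrameU L M β U μ n with hK
  -- the rate `ρ = (2^d)⁻¹ ∈ (0, 1)` and the block gain `γ = (2^{d−1})⁻¹ ≤ 1`
  set ρ : ℝ := ((2 : ℝ) ^ d)⁻¹ with hρ
  have hsd1 : (1 : ℝ) < (2 : ℝ) ^ d := one_lt_pow₀ (by norm_num) (by omega)
  have hρ0 : 0 < ρ := by positivity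
  have hρ1 : ρ < 1 := inv_lt_one_of_one_lt₀ hsd1
  have hρle : ρ ≤ 1 := hρ1.le
  have h1ρ : 0 < 1 - ρ := sub_pos.2 hρ1
  set γ : ℝ := ((2 : ℝ) ^ (d - 1))⁻¹ with hγ
  have hγ0 : 0 ≤ γ := by positivity
  have hγ1 : γ ≤ 1 := inv_le_one_of_one_le₀ (one_le_pow₀ (by norm_num))
  -- the exponent `e = p − 3` and the gain `G = γ^e ≤ 8^{d−1}·γ^p`
  set e : ℕ := p - 3 with he
  set Gn : ℝ := γ ^ e with hGn
  have hGn0 : 0 ≤ Gn := by positivity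
  have hGle : Gn ≤ (8 : ℝ) ^ (d - 1) * (((2 : ℝ) ^ (d - 1))⁻¹) ^ p := by
    rw [hGn]
    refine le_of_eq ?_
    have h2 : (0 : ℝ) < (2 : ℝ) ^ (d - 1) := by positivity
    obtain ⟨q, rfl⟩ : ∃ q, p = q + 3 := ⟨p - 3, by omega⟩
    rw [he, Nat.add_sub_cancel, hγ, pow_add, inv_pow, inv_pow]
    have h8 : (8 : ℝ) ^ (d - 1) = ((2 : ℝ) ^ (d - 1)) ^ 3 := by
      rw [← pow_mul, mul_comm, pow_mul]; norm_num
    rw [h8]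
    field_simp
  have hmain := h' G P Q cc hcc hcc6 hcc₃' μ hμ U hU hUle hU₀' hcU β hβmin hβc L M hL3 hM3 n hn1 hnN hkl hhist hosc d k hd hk2 hkn j hj p (by omega)
    (Nb p) (hNb0 p) (hcar p)
  -- laws
  set law : ℕ → ℝ := fun p => A * lam ^ (p - 1) * Q' ^ p with hlaw
  have hlaw0 : 0 ≤ law p := by positivity
  have hu0 : 0 < klLevUnitF β M 0 p (d - 1) := klLevUnitF_pos hβ 0 p (d - 1)
  -- (i) the base term carries `γ^e` (since `dk − 1 ≥ d − 1`)
  have hUVt : ((2 : ℝ) ^ e)⁻¹ ^ (d * (k - 1)) * (Nb p / klLevUnitF β M 0 p (d - 1)) ≤ Gn * (Ab * lam ^ (p - 1) * Qb ^ p) := by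
    have hb : ((2 : ℝ) ^ e)⁻¹ ≤ 1 := inv_le_one_of_one_le₀ (one_le_pow₀ (by norm_num))
    have hb0 : 0 ≤ ((2 : ℝ) ^ e)⁻¹ := by positivity
    have hdk : d - 1 ≤ d * (k - 1) := by
      have : d * 1 ≤ d * (k - 1) := Nat.mul_le_mul_left d (by omega)
      omega
    have hpow : ((2 : ℝ) ^ e)⁻¹ ^ (d * (k - 1)) ≤ ((2 : ℝ) ^ e)⁻¹ ^ (d - 1) := pow_le_pow_of_le_one hb0 hb hdk
    have hGeq : ((2 : ℝ) ^ e)⁻¹ ^ (d - 1) = Gn := by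
      rw [hGn, hγ, inv_pow, inv_pow, ← pow_mul, ← pow_mul, mul_comm]
    have hq0 : 0 ≤ Nb p / klLevUnitF β M 0 p (d - 1) := div_nonneg (hNb0 p) hu0.le
    calc ((2 : ℝ) ^ e)⁻¹ ^ (d * (k - 1)) * (Nb p / klLevUnitF β M 0 p (d - 1)) ≤ Gn * (Nb p / klLevUnitF β M 0 p (d - 1)) := by
          rw [← hGeq]; exact mul_le_mul_of_nonneg_right hpow hq0
      _ ≤ Gn * (Ab * lam ^ (p - 1) * Qb ^ p) := mul_le_mul_of_nonneg_left (hlawb p (by omega)) hGn0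
  -- (ii) the born sum: each term `≤ G·ρ^{k−1−k′}·law`, the sum `≤ G·law/(1−ρ)`
  have hterm : ∀ k' ∈ Ico 1 k, (2 : ℝ) ^ e * ρ ^ (e * (k - k')) *
      (klTowerBornWtAt L M β U μ K d k' j (2 * p) / klLevUnitF β M 0 p (d * k')) ≤ Gn * ρ ^ (k - 1 - k') * law p := by
    intro k' hk'
    obtain ⟨hk'1, hk'⟩ := mem_Ico.1 hk'
    obtain ⟨n', hn⟩ : ∃ n', k - k' = n' + 1 := ⟨k - k' - 1, by omega⟩
    have hkn : k - 1 - k' = n' := by omega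
    have hb : klTowerBornWtAt L M β U μ K d k' j (2 * p) / klLevUnitF β M 0 p (d * k') ≤ law p := by
      have h1 := hIH (k' + 1) (by omega) (by omega) p (by omega) hpD
      simp only [Nat.add_sub_cancel] at h1
      exact h1
    have hb0 : 0 ≤ klTowerBornWtAt L M β U μ K d k' j (2 * p) / klLevUnitF β M 0 p (d * k') := towerBWt_nonneg hβ U μ K d k' j p
    have hrate : (2 : ℝ) ^ e * ρ ^ (e * (k - k')) ≤ Gn * ρ ^ (k - 1 - k') := by
      rw [hn, hkn, show e * (n' + 1) = e + e * n' by ring, pow_add, ← mul_assoc]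
      have h1 : (2 : ℝ) ^ e * ρ ^ e = Gn := by rw [hGn, hγ, hρ]; exact two_pow_mul_inv_pow_eq_F (by omega) e
      have h2 : ρ ^ (e * n') ≤ ρ ^ n' := by
        rw [mul_comm, pow_mul]
        exact pow_le_of_le_one (by positivity) (pow_le_one₀ hρ0.le hρle) (by omega)
      rw [h1]
      exact mul_le_mul_of_nonneg_left h2 hGn0
    calc (2 : ℝ) ^ e * ρ ^ (e * (k - k')) * (klTowerBornWtAt L M β U μ K d k' j (2 * p) / klLevUnitF β M 0 p (d * k'))
        ≤ Gn * ρ ^ (k - 1 - k') * (klTowerBornWtAt L M β U μ K d k' j (2 * p) / klLevUnitF β M 0 p (d * k')) :=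
          mul_le_mul_of_nonneg_right hrate hb0
      _ ≤ Gn * ρ ^ (k - 1 - k') * law p := mul_le_mul_of_nonneg_left hb (by positivity)
  have hsum : ∑ k' ∈ Ico 1 k, (2 : ℝ) ^ e * ρ ^ (e * (k - k')) *
      (klTowerBornWtAt L M β U μ K d k' j (2 * p) / klLevUnitF β M 0 p (d * k')) ≤ Gn * (law p / (1 - ρ)) := by
    refine (sum_le_sum hterm).trans ?_
    have hsub : Ico 1 k ⊆ range k := fun k' hk' => mem_range.2 (mem_Ico.1 hk').2
    refine (sum_le_sum_of_subset_of_nonneg hsub (fun k' _ _ => by positivity)).trans ?_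
    have hre : ∑ k' ∈ range k, Gn * ρ ^ (k - 1 - k') * law p = Gn * ((∑ i ∈ range k, ρ ^ i) * law p) := by
      rw [← sum_range_reflect (fun i => ρ ^ i) k, sum_mul, mul_sum]
      refine sum_congr rfl fun k' _ => ?_
      ring
    rw [hre]
    refine mul_le_mul_of_nonneg_left ?_ hGn0
    have hgeom : ∑ i ∈ range k, ρ ^ i ≤ 1 / (1 - ρ) := by
      rw [range_eq_Ico]; simpa using geom_sum_Ico_le_of_lt_one hρ0.le hρ1 (m := 0) (n := k)
    calc (∑ i ∈ range k, ρ ^ i) * law p ≤ 1 / (1 - ρ) * law p :=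
          mul_le_mul_of_nonneg_right hgeom hlaw0
      _ = law p / (1 - ρ) := by rw [one_div, inv_mul_eq_div]
  -- (iii) assemble
  have hpre0 : 0 ≤ C₁ * C₂ ^ (2 * p - 1) := by positivity
  set Mq := max Q' Qb with hMq
  have hQM : Q' ≤ Mq := le_max_left _ _
  have hQbM : Qb ≤ Mq := le_max_right _ _
  have hMq0 : 0 ≤ Mq := hQ.trans hQM
  set δ : ℝ := ((2 : ℝ) ^ (d - 1))⁻¹ with hδ
  have hδ0 : 0 ≤ δ := by positivity
  have hin : Ab * lam ^ (p - 1) * Qb ^ p + law p / (1 - ρ) ≤ (Ab + A / (1 - ρ)) * lam ^ (p - 1) * Mq ^ p := by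
    have h1 : Ab * lam ^ (p - 1) * Qb ^ p ≤ Ab * lam ^ (p - 1) * Mq ^ p :=
      mul_le_mul_of_nonneg_left (pow_le_pow_left₀ hQb hQbM p) (by positivity)
    have h2 : law p / (1 - ρ) ≤ A / (1 - ρ) * lam ^ (p - 1) * Mq ^ p := by
      rw [hlaw]; dsimp only
      rw [div_eq_mul_inv, show A / (1 - ρ) * lam ^ (p - 1) * Mq ^ p = A * lam ^ (p - 1) * Mq ^ p * (1 - ρ)⁻¹ by ring]
      exact mul_le_mul_of_nonneg_right (mul_le_mul_of_nonneg_left (pow_le_pow_left₀ hQ hQM p) (by positivity))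
        (inv_nonneg.2 h1ρ.le)
    calc Ab * lam ^ (p - 1) * Qb ^ p + law p / (1 - ρ) ≤ Ab * lam ^ (p - 1) * Mq ^ p + A / (1 - ρ) * lam ^ (p - 1) * Mq ^ p :=
          add_le_add h1 h2
      _ = (Ab + A / (1 - ρ)) * lam ^ (p - 1) * Mq ^ p := by ring
  have hA0 : 0 ≤ Ab + A / (1 - ρ) := by have : 0 ≤ A / (1 - ρ) := div_nonneg hA h1ρ.le; positivity
  have hin0 : 0 ≤ (Ab + A / (1 - ρ)) * lam ^ (p - 1) * Mq ^ p := by positivity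
  have hC : C₁ * C₂ ^ (2 * p - 1) = C₁ / C₂ * (C₂ ^ 2) ^ p := by
    have hpw : (C₂ ^ 2) ^ p = C₂ ^ (2 * p - 1) * C₂ := by
      rw [← pow_mul, ← pow_succ]; congr 1; omega
    rw [hpw]
    field_simp
  calc klTowerMeasWtAt L M β U μ K d k j (2 * p) / klLevUnitF β M 0 p (d * k - 1)
      ≤ C₁ * C₂ ^ (2 * p - 1) *
          (((2 : ℝ) ^ e)⁻¹ ^ (d * (k - 1)) * (Nb p / klLevUnitF β M 0 p (d - 1)) +
            ∑ k' ∈ Ico 1 k, (2 : ℝ) ^ e * ρ ^ (e * (k - k')) *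
              (klTowerBornWtAt L M β U μ K d k' j (2 * p) / klLevUnitF β M 0 p (d * k'))) := hmain
    _ ≤ C₁ * C₂ ^ (2 * p - 1) * (Gn * (Ab * lam ^ (p - 1) * Qb ^ p) + Gn * (law p / (1 - ρ))) :=
        mul_le_mul_of_nonneg_left (add_le_add hUVt hsum) hpre0
    _ = C₁ * C₂ ^ (2 * p - 1) * Gn * (Ab * lam ^ (p - 1) * Qb ^ p + law p / (1 - ρ)) := by ring
    _ ≤ C₁ * C₂ ^ (2 * p - 1) * ((8 : ℝ) ^ (d - 1) * δ ^ p) * ((Ab + A / (1 - ρ)) * lam ^ (p - 1) * Mq ^ p) := by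
        have hsum0 : 0 ≤ Ab * lam ^ (p - 1) * Qb ^ p + law p / (1 - ρ) := add_nonneg (by positivity) (div_nonneg hlaw0 h1ρ.le)
        have h1 : C₁ * C₂ ^ (2 * p - 1) * Gn ≤ C₁ * C₂ ^ (2 * p - 1) * ((8 : ℝ) ^ (d - 1) * δ ^ p) :=
          mul_le_mul_of_nonneg_left hGle hpre0
        exact mul_le_mul h1 hin hsum0 (by positivity)
    _ = C₁ / C₂ * (8 : ℝ) ^ (d - 1) * (Ab + A / (1 - ρ)) * lam ^ (p - 1) * (C₂ ^ 2 * δ * Mq) ^ p := by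
        rw [hC, mul_pow, mul_pow]; ring

/-! ## §2 The weighted law on the flow frame with the bridge discharged -/

omit [NeZero L] [NeZero M] in
/-- **THE RE-BASED ONE-TRACK WEIGHTED TOWER LAW ON `K_n`, BRIDGE DISCHARGED, TOKEN CARRIED, PROFILE ROWS EXPORTED** — W1's
`klTowerBornWtAt_le_law_of_inputs_base_tokX` at `K := klFlowFrameU … n` with `hR` from `klTowerMeasWtAt_div_le_profileR_base_klEng`: under the binders of the
weighted re-measurement rows (v1-type doors with the jump rows' thresholds `c ≤ c₃′`, `U ≤ U₀′`, an admissible history at scale `n`, the (K5′) clauses), given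
`2 ≤ d`, a block count `Kb` with `d·Kb − 1 ≤ n`, a cap `D ≥ 3`, a rate `j` with `d·Kb − 1 ≤ j`, the base datum `N_b` with its unit law `(A_b, Q_b)`, the scalings
`W, Z > 0` and profile constants `A′ ≥ W·(C₁/C₂)8^{d−1}(A_b + A/(1−(2^d)⁻¹))`, `Q′ ≥ Z·C₂²(2^{d−1})⁻¹·max Q Q_b`, the block-`1` profile, the imports `ι₁ ι₂ ι₃` at
every block `1 ≤ k ≤ Kb`, the token (`hZ1`, `hZsucc`), the tokenised step at the blocks `1 ≤ k < Kb` and the kit's numerics: the token holds at every block, the born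
arrays of the blocks `2 ≤ k ≤ Kb` obey `Aλ^{p−1}Q^p` (`3 ≤ p ≤ D`) and the measured profile rows hold at every block `1 ≤ k ≤ Kb`.
[cite: BenfattoGiulianiMastropietro2006, §2.8 (2.83), (2.93)-(2.98)] -/
theorem klTowerBornWtAt_le_law_of_base_rows_klEng_tokX (R : RenConsts) (c'' : ℝ) (hc'' : 0 < c'') :
    ∃ C₁ C₂ : ℝ, 0 < C₁ ∧ 0 < C₂ ∧ (R.WF2 → ∃ c₃' : ℝ, 0 < c₃' ∧ ∃ U₀' : ℝ, 0 < U₀' ∧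
      ∀ (G : GeoConsts) (P : SplitConsts) (Q : EngConsts) (c : ℝ), 0 < c → c ≤ klEngC₃6 P R → c ≤ c₃' →
      ∀ μ ∈ klWindowC, ∀ U : ℝ, 0 < U → U ≤ klEngU₀9 P R c → U ≤ U₀' → c'' * U ≤ 1 →
      ∀ β : ℝ, klBetaMin ≤ β → β ≤ Real.exp (c / U ^ 2) →
      ∀ (L M : ℕ) [NeZero L] [NeZero M], klEngL₃ β U ≤ L → klEngM₃ β U L ≤ M →
      ∀ n : ℕ, 1 ≤ n → n ≤ nScales β + 1 → IsKLRegime U c (-(n : ℤ)) → HistP klPredsV17F2 L M G P Q R β U μ 0 n →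
        (∀ m', 1 ≤ m' → m' < n → FlowPieceOscAt L M c'' β U μ m') →
      ∀ d Kb D : ℕ, 2 ≤ d → d * Kb - 1 ≤ n → 3 ≤ D → ∀ j : ℕ, d * Kb - 1 ≤ j →
      ∀ (A lam Q' Ab Qb : ℝ), 0 ≤ A → 0 < lam → 0 < Q' → 0 ≤ Ab → 0 ≤ Qb →
      -- the base datum at `(F_{d−1}, rate j)` and its unit law (p3's weighted grid step at `(Λ_d, F_{d−1})`)
      ∀ Nb : ℕ → ℝ, (∀ p, 0 ≤ Nb p) →
        (∀ (p : ℕ) (q : Fin (2 * p)) (w' : SpaceTimeIdx L M × SectorLeg (sectorCount (d - 1))),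
          klWtPinnedSumAt L M β μ (klFlowFrameU L M β U μ n) (d - 1) j (2 * p) (klTowerInput L M β U μ (klFlowFrameU L M β U μ n) d 1) q w' ≤ Nb p) →
        (∀ p : ℕ, 3 ≤ p → Nb p / klLevUnitF β M 0 p (d - 1) ≤ Ab * lam ^ (p - 1) * Qb ^ p) →
      ∀ (W Z A' Q'' : ℝ), 0 < W → 0 < Z →
        W * ((C₁ / C₂) * (8 : ℝ) ^ (d - 1) * (Ab + A / (1 - ((2 : ℝ) ^ d)⁻¹))) ≤ A' →
        Z * (C₂ ^ 2 * ((2 : ℝ) ^ (d - 1))⁻¹ * max Q' Qb) ≤ Q'' → 0 < Q'' →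
      ∀ (σ Φ ψ τ ι₁ ι₂ ι₃ : ℝ), 0 ≤ σ → 0 ≤ Φ → 0 ≤ ψ → 0 < τ → ∀ Zk : ℕ → Prop,
      -- the block-1 profile (named)
      (∀ m, 4 ≤ m → m ≤ D → W * Z ^ m *
        (klTowerMeasWtAt L M β U μ (klFlowFrameU L M β U μ n) d 1 j (2 * m) / klLevUnitF β M 0 m (d * 1 - 1)) ≤ A' * lam ^ (m - 1) * Q'' ^ m) →
      -- the weighted imports (degrees 2, 4, 6) at every block 1 ≤ k ≤ Kb
      (∀ k, 1 ≤ k → k ≤ Kb → W * Z ^ 1 *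
        (klTowerMeasWtAt L M β U μ (klFlowFrameU L M β U μ n) d k j (2 * 1) / klLevUnitF β M 0 1 (d * k - 1)) ≤ ι₁ * lam) →
      (∀ k, 1 ≤ k → k ≤ Kb → W * Z ^ 2 *
        (klTowerMeasWtAt L M β U μ (klFlowFrameU L M β U μ n) d k j (2 * 2) / klLevUnitF β M 0 2 (d * k - 1)) ≤ ι₂ * lam) →
      (∀ k, 1 ≤ k → k ≤ Kb → W * Z ^ 3 *
        (klTowerMeasWtAt L M β U μ (klFlowFrameU L M β U μ n) d k j (2 * 3) / klLevUnitF β M 0 3 (d * k - 1)) ≤ ι₃ * lam ^ 2) →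
      -- the token: base and propagation under the step's guard
      Zk 1 →
      (∀ k, 1 ≤ k → k < Kb → Zk k →
        Φ * towerV D τ (fun m => W * Z ^ m *
          (klTowerMeasWtAt L M β U μ (klFlowFrameU L M β U μ n) d k j (2 * m) / klLevUnitF β M 0 m (d * k - 1))) < 1 → Zk (k + 1)) →
      -- the tokenised weighted step at blocks 1 ≤ k < Kb (W2b)
      (∀ k, 1 ≤ k → k < Kb → Zk k → ∀ N : ℕ, 2 ≤ N → ∀ p, 3 ≤ p → p ≤ D →
        Φ * towerV D τ (fun m => W * Z ^ m *
          (klTowerMeasWtAt L M β U μ (klFlowFrameU L M β U μ n) d k j (2 * m) / klLevUnitF β M 0 m (d * k - 1))) < 1 →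
        klTowerBornWtAt L M β U μ (klFlowFrameU L M β U μ n) d k j (2 * p) / klLevUnitF β M 0 p (d * k) ≤
          towerFO D σ (fun m => W * Z ^ m *
              (klTowerMeasWtAt L M β U μ (klFlowFrameU L M β U μ n) d k j (2 * m) / klLevUnitF β M 0 m (d * k - 1))) p +
            ∑ n' ∈ Icc 2 N, exp 1 * Φ ^ (n' - 1) * ψ ^ p *
              towerS D τ (fun m => W * Z ^ m *
                (klTowerMeasWtAt L M β U μ (klFlowFrameU L M β U μ n) d k j (2 * m) / klLevUnitF β M 0 m (d * k - 1))) n' p +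
            ψ ^ p * exp 1 * towerV D τ (fun m => W * Z ^ m *
                (klTowerMeasWtAt L M β U μ (klFlowFrameU L M β U μ n) d k j (2 * m) / klLevUnitF β M 0 m (d * k - 1))) *
              (Φ * towerV D τ (fun m => W * Z ^ m *
                (klTowerMeasWtAt L M β U μ (klFlowFrameU L M β U μ n) d k j (2 * m) / klLevUnitF β M 0 m (d * k - 1)))) ^ N /
              (1 - Φ * towerV D τ (fun m => W * Z ^ m *
                (klTowerMeasWtAt L M β U μ (klFlowFrameU L M β U μ n) d k j (2 * m) / klLevUnitF β M 0 m (d * k - 1))))) →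
      -- the kit's numerics
      4 * σ * lam * Q'' < 1 → 2 * lam * τ * Q'' ≤ 1 → exp 1 * τ * lam * Q'' < 1 →
      Φ * (τ * (ι₁ * lam + ι₂ / (2 * Q'') + ι₃ / (4 * Q'' ^ 2) + A' * Q'' / 4)) < 1 →
      Φ * (exp 1 * τ * (ι₁ * lam) + (exp 1 * τ) ^ 2 * (ι₂ * lam) + (exp 1 * τ) ^ 3 * (ι₃ * lam ^ 2) +
        A' * (exp 1 * τ * Q'') * ((exp 1 * τ * lam * Q'') ^ 3 / (1 - exp 1 * τ * lam * Q''))) < 1 →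
      4 * Q'' ≤ Q' → 2 * τ * ψ * Q'' ≤ Q' →
      A' * (4 * Q'') ^ 3 * (4 * σ * lam * Q'' / (1 - 4 * σ * lam * Q'')) +
        exp 1 * ψ * (2 * τ * ψ * Q'') ^ 2 * (τ * (ι₁ * lam + ι₂ / (2 * Q'') + ι₃ / (4 * Q'' ^ 2) + A' * Q'' / 4)) *
          (Φ * (τ * (ι₁ * lam + ι₂ / (2 * Q'') + ι₃ / (4 * Q'' ^ 2) + A' * Q'' / 4)) /
            (1 - Φ * (τ * (ι₁ * lam + ι₂ / (2 * Q'') + ι₃ / (4 * Q'' ^ 2) + A' * Q'' / 4)))) ≤ A * Q' ^ 3 →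
      (∀ k, 1 ≤ k → k ≤ Kb → Zk k) ∧
      (∀ k, 2 ≤ k → k ≤ Kb → ∀ p : ℕ, 3 ≤ p → p ≤ D →
        klTowerBornWtAt L M β U μ (klFlowFrameU L M β U μ n) d (k - 1) j (2 * p) / klLevUnitF β M 0 p (d * (k - 1)) ≤ A * lam ^ (p - 1) * Q' ^ p) ∧
      (∀ k, 1 ≤ k → k ≤ Kb → ∀ m, 4 ≤ m → m ≤ D → W * Z ^ m *
        (klTowerMeasWtAt L M β U μ (klFlowFrameU L M β U μ n) d k j (2 * m) / klLevUnitF β M 0 m (d * k - 1)) ≤ A' * lam ^ (m - 1) * Q'' ^ m)) := by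
  obtain ⟨C₁, C₂, hC₁, hC₂, h⟩ := klTowerMeasWtAt_div_le_profileR_base_klEng R c'' hc''.le
  refine ⟨C₁, C₂, hC₁, hC₂, fun hR2 => ?_⟩
  obtain ⟨c₃, hc₃, U₀, hU₀, h'⟩ := h hR2
  refine ⟨c₃, hc₃, U₀, hU₀, ?_⟩
  intro G P Q c hc hc6 hc₃' μ hμ U hU hU9 hU₀' hcU β hβmin hβc L M _ _ hL3 hM3 n hn1 hnN hkl hhist hosc d Kb D hd hKbn hD3 j hKbj
    A lam Q' Ab Qb hA hlam hQ hAb hQb Nb hNb0 hcar hlawb W Z A' Q'' hW hZ hA'1 hQ'1 hQ'0 σ Φ ψ τ ι₁ ι₂ ι₃ hσ hΦ hψ hτ Zk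
    hbase hι₁ hι₂ hι₃ hZ1 hZsucc hstep hx₁ hx₂ hx₃ hy hθ hu₁ hu₂ hclose
  have hβ : 0 < β := KLRegimeSplit.pos_of_klBetaMin_le hβmin
  have hU3g : U ≤ min (klEngU₀3 P R c) (1 / (R.Gfr 3 + 1)) :=
    le_min (hU9.trans (klEngU₀9_le_klEngU₀3 P R c)) (hU9.trans (klEngU₀9_le_inv_gfr_add_one P hR2.wf c (by norm_num)))
  set K : TrigPolyC4v := klFlowFrameU L M β U μ n with hK
  -- the profile constants of the weighted `R` rows and their domination by `A′, Q″`
  set AR : ℝ := (C₁ / C₂) * (8 : ℝ) ^ (d - 1) * (Ab + A / (1 - ((2 : ℝ) ^ d)⁻¹)) with hAR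
  set QR : ℝ := C₂ ^ 2 * ((2 : ℝ) ^ (d - 1))⁻¹ * max Q' Qb with hQR
  have hρ1 : ((2 : ℝ) ^ d)⁻¹ < 1 := inv_lt_one_of_one_lt₀ (one_lt_pow₀ (by norm_num) (by omega))
  have hAR0 : 0 ≤ AR := by
    have : 0 ≤ A / (1 - ((2 : ℝ) ^ d)⁻¹) := div_nonneg hA (sub_nonneg.2 hρ1.le)
    positivity
  have hQR0 : 0 ≤ QR := by
    have : 0 ≤ max Q' Qb := le_max_of_le_left hQ.le
    positivity
  have hA'0 : 0 ≤ A' := le_trans (by positivity) hA'1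
  have hdom : ∀ m : ℕ, W * Z ^ m * (AR * lam ^ (m - 1) * QR ^ m) ≤ A' * lam ^ (m - 1) * Q'' ^ m := fun m => by
    rw [show W * Z ^ m * (AR * lam ^ (m - 1) * QR ^ m) = W * AR * lam ^ (m - 1) * (Z * QR) ^ m by rw [mul_pow]; ring]
    exact mul_le_mul (mul_le_mul_of_nonneg_right hA'1 (pow_nonneg hlam.le _)) (pow_le_pow_left₀ (by positivity) hQ'1 m)
      (pow_nonneg (by positivity) _) (by positivity)
  have hWZ : ∀ m : ℕ, 0 ≤ W * Z ^ m := fun m => by positivity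
  refine klTowerBornWtAt_le_law_of_inputs_base_tokX hβ U μ K j d Kb D hD3 hA hlam hQ.le hW.le hZ.le hA'0 hQ'0 hσ hΦ hψ hτ hbase ?_
    hι₁ hι₂ hι₃ hZ1 hZsucc hstep hx₁ hx₂ hx₃ hy hθ hu₁ hu₂ hclose
  -- the bridge `hR` at the blocks `k ≥ 2`, from the weighted `R` rows
  intro k hk2 hkK ih m hm hmD
  have hd2k : d * 2 ≤ d * k := Nat.mul_le_mul_left d hk2
  have hkKd : d * k ≤ d * Kb := Nat.mul_le_mul_left d hkK
  have hrow := h' G P Q c hc hc6 hc₃' μ hμ U hU hU3g hU₀' hcU β hβmin hβc L M hL3 hM3 n hn1 hnN hkl hhist hosc d k hd hk2 (by omega) j (by omega) D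
    A lam Q' Ab Qb hA hlam.le hQ.le hAb hQb Nb hNb0 hcar hlawb ih m hm hmD
  exact (mul_le_mul_of_nonneg_left hrow (hWZ m)).trans (hdom m)

end Summit.HubbardSuperconductivity.HubbardSuperconductivity.Theorems.EngineV8

end
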